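import Literature.NumberTheory.Automorphic.UnitaryGroupLocalCongr
import Literature.NumberTheory.Automorphic.RestrictedTensorProductCentralCoinvariants
import HarnessLib

/-!
# «T1»: a restricted tensor product structure transports along the congruence `U(J')(𝔸_f) ≃ U(J)(𝔸_f)`

Topic `NumberTheory/Automorphic`; namespace `Literature.NumberTheory.Automorphic.UnitaryGroup`.  Sequel (proof lane, theorems only) to ★
«D5» `UnitaryGroupLocalCongr`.  If the restricted-product model `ρ ∘ finAdelicEquiv_J⁻¹` of a representation `ρ` of `U(J)(𝔸_{F,f})` is a
restricted tensor product `⊗'_v (ρ_v, x₀ v)` (★ `IsRestrictedTensorProductRep`), then for a rational similitude `ᵗ(cB)·(a•J)·B = J'` the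
model `(ρ ∘ finAdelicCongr) ∘ finAdelicEquiv_{J'}⁻¹` of the transported representation `ρ ∘ finAdelicCongr` of `U(J')(𝔸_{F,f})` is the
restricted tensor product `⊗'_v (ρ_v ∘ κ_v, x₀ v)` of the local representations pulled back along the local congruences
`κ_v = localCongr … v` (★ `IsRestrictedTensorProductRep.comp` along `(κ_v)_v`, which respect the integral levels off a finite set — ★
`eventually_mapsTo_localCongr_localInt` — and ★ `finAdelicEquiv_comp_finAdelicCongr`: `finAdelicEquiv_J ∘ finAdelicCongr = (Πʳ κ_v) ∘
finAdelicEquiv_{J'}`).  This is socket «T1» of the cell `hodgecm-mathlib`'s d6 S4 assembly (A-p05 (g11) census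
`CENSUS-D6-S4-final-assembly`), in one call.  Flath §2 Example 2; Platonov–Rapinchuk §5.1.  No named fact, no `sorry`.

## References
* D. Flath, Corvallis 1979, part 1, §2 Example 2 [Flath1979].
* V. Platonov, A. Rapinchuk, *Algebraic Groups and Number Theory* (1994), §5.1 [PlatonovRapinchuk1994].
-/

noncomputable section

open NumberField IsDedekindDomain Filter Set
open scoped Matrix MatrixGroups RestrictedProduct

namespace Literature.NumberTheory.Automorphic

namespace UnitaryGroup

variable {F E : Type} [Field F] [NumberField F] [Field E] [NumberField E] [Algebra F E]
  {c : E ≃ₐ[F] E} {N : ℕ} (B : GL (Fin N) E) {a : E} (ha : a ≠ 0) {J J' : Matrix (Fin N) (Fin N) E}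
  (h : formCongr (c : E →+* E) B (a • J) = J')

/-- `finAdelicCongr` read in the restricted-product models: `finAdelicCongr (finAdelicEquiv_{J'}⁻¹ x) = finAdelicEquiv_J⁻¹ ((Πʳ κ_v) x)`.
[cite: PlatonovRapinchuk1994, §5.1] -/
theorem finAdelicCongr_finAdelicEquiv_symm_apply
    (x : Πʳ v : HeightOneSpectrum (𝓞 F), [localPi E c N J' v, localInt E c N J' v]) :
    finAdelicCongr F E c B ha h ((finAdelicEquiv F E c N J').symm x) =
      (finAdelicEquiv F E c N J).symm
        (RestrictedProduct.mapAlongMonoidHom (fun v => localPi E c N J' v) (fun v => localPi E c N J v) id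
          Filter.tendsto_id (fun v => (localCongr E c B ha h v).toMonoidHom)
          (eventually_mapsTo_localCongr_localInt F E c B ha h) x) := by
  apply (finAdelicEquiv F E c N J).injective
  rw [ContinuousMulEquiv.apply_symm_apply]
  have := congrArg (fun f => f ((finAdelicEquiv F E c N J').symm x)) (finAdelicEquiv_comp_finAdelicCongr F E c B ha h)
  simp only [MonoidHom.coe_comp, Function.comp_apply] at this
  convert this using 2 <;> first | rfl | exact ((finAdelicEquiv F E c N J').apply_symm_apply x).symm

/-- The transported representation read in the restricted-product models:
`(ρ ∘ finAdelicCongr) ∘ finAdelicEquiv_{J'}⁻¹ = (ρ ∘ finAdelicEquiv_J⁻¹) ∘ (Πʳ κ_v)` (★ `finAdelicEquiv_comp_finAdelicCongr`).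
[cite: PlatonovRapinchuk1994, §5.1] -/
theorem comp_finAdelicCongr_comp_finAdelicEquiv_symm {k V : Type*} [CommRing k] [AddCommGroup V] [Module k V]
    (ρ : Representation k (finAdelic F E c N J) V) :
    (ρ.comp (finAdelicCongr F E c B ha h).toMonoidHom).comp (finAdelicEquiv F E c N J').symm.toMonoidHom =
      (ρ.comp (finAdelicEquiv F E c N J).symm.toMonoidHom).comp
        (RestrictedProduct.mapAlongMonoidHom (fun v => localPi E c N J' v) (fun v => localPi E c N J v) id
          Filter.tendsto_id (fun v => (localCongr E c B ha h v).toMonoidHom)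
          (eventually_mapsTo_localCongr_localInt F E c B ha h)) :=
  MonoidHom.ext fun x => congrArg ρ (finAdelicCongr_finAdelicEquiv_symm_apply B ha h x)

open scoped Classical in
/-- **«T1»: `⊗'` transports along the congruence** (restricted-product form).  If `ρ ∘ finAdelicEquiv_J⁻¹ ≅ ⊗'_v (ρ_v, x₀ v)` then
`(ρ ∘ finAdelicEquiv_J⁻¹) ∘ (Πʳ κ_v) ≅ ⊗'_v (ρ_v ∘ κ_v, x₀ v)` with the same `j` and exceptional set (★ `IsRestrictedTensorProductRep.comp`
along the local congruences, levels matched off a finite set by ★ `eventually_mapsTo_localCongr_localInt`); by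
`comp_finAdelicCongr_comp_finAdelicEquiv_symm` the representation is `(ρ ∘ finAdelicCongr) ∘ finAdelicEquiv_{J'}⁻¹`.
[cite: Flath1979, §2 Example 2] [cite: PlatonovRapinchuk1994, §5.1] -/
theorem isRestrictedTensorProductRep_comp_localCongr {k : Type*} [Field k] {V : Type*} [AddCommGroup V] [Module k V]
    (ρ : Representation k (finAdelic F E c N J) V)
    {Vv : HeightOneSpectrum (𝓞 F) → Type*} [∀ v, AddCommGroup (Vv v)] [∀ v, Module k (Vv v)]
    {ρv : ∀ v : HeightOneSpectrum (𝓞 F), Representation k (localPi E c N J v) (Vv v)} {x₀ : ∀ v, Vv v}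
    {hx₀ : ∀ᶠ v in cofinite, x₀ v ∈ (ρv v).fixedPoints (localInt E c N J v)}
    {jW : RestrictedFamily Vv x₀ → V} {S₀ : Finset (HeightOneSpectrum (𝓞 F))}
    (hρ : IsRestrictedTensorProductRep ρv (ρ.comp (finAdelicEquiv F E c N J).symm.toMonoidHom) hx₀ jW S₀) :
    IsRestrictedTensorProductRep (K := fun v => localInt E c N J' v)
      (fun v => show Representation k (localPi E c N J' v) (Vv v) from (ρv v).comp (localCongr E c B ha h v).toMonoidHom)
      ((ρ.comp (finAdelicEquiv F E c N J).symm.toMonoidHom).comp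
        (RestrictedProduct.mapAlongMonoidHom (fun v => localPi E c N J' v) (fun v => localPi E c N J v) id
          Filter.tendsto_id (fun v => (localCongr E c B ha h v).toMonoidHom)
          (eventually_mapsTo_localCongr_localInt F E c B ha h)))
      (Representation.eventually_mem_fixedPoints_comp (fun v => (localCongr E c B ha h v).toMonoidHom) hx₀
        (eventually_mapsTo_localCongr_localInt F E c B ha h)) jW S₀ :=
  hρ.comp (fun v => (localCongr E c B ha h v).toMonoidHom) (eventually_mapsTo_localCongr_localInt F E c B ha h)

open scoped Classical in
/-- **«T1» in one call**: if `ρ ∘ finAdelicEquiv_J⁻¹ ≅ ⊗'_v (ρ_v, x₀ v)` then `(ρ ∘ finAdelicCongr) ∘ finAdelicEquiv_{J'}⁻¹ ≅ ⊗'_v (ρ_v ∘ κ_v, x₀ v)`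
(same `j`, same exceptional set) — the `h`-input of ★ `IsHyperspecialAt.heckeTAt_apply_eq_smul` for the transported representation
`ρ ∘ finAdelicCongr` of `U(J')(𝔸_{F,f})`. [cite: Flath1979, §2 Example 2] [cite: PlatonovRapinchuk1994, §5.1] -/
theorem isRestrictedTensorProductRep_comp_finAdelicCongr {k : Type*} [Field k] {V : Type*} [AddCommGroup V] [Module k V]
    (ρ : Representation k (finAdelic F E c N J) V)
    {Vv : HeightOneSpectrum (𝓞 F) → Type*} [∀ v, AddCommGroup (Vv v)] [∀ v, Module k (Vv v)]
    {ρv : ∀ v : HeightOneSpectrum (𝓞 F), Representation k (localPi E c N J v) (Vv v)} {x₀ : ∀ v, Vv v}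
    {hx₀ : ∀ᶠ v in cofinite, x₀ v ∈ (ρv v).fixedPoints (localInt E c N J v)}
    {jW : RestrictedFamily Vv x₀ → V} {S₀ : Finset (HeightOneSpectrum (𝓞 F))}
    (hρ : IsRestrictedTensorProductRep ρv (ρ.comp (finAdelicEquiv F E c N J).symm.toMonoidHom) hx₀ jW S₀) :
    IsRestrictedTensorProductRep (K := fun v => localInt E c N J' v)
      (fun v => show Representation k (localPi E c N J' v) (Vv v) from (ρv v).comp (localCongr E c B ha h v).toMonoidHom)
      ((ρ.comp (finAdelicCongr F E c B ha h).toMonoidHom).comp (finAdelicEquiv F E c N J').symm.toMonoidHom)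
      (Representation.eventually_mem_fixedPoints_comp (fun v => (localCongr E c B ha h v).toMonoidHom) hx₀
        (eventually_mapsTo_localCongr_localInt F E c B ha h)) jW S₀ := by
  convert isRestrictedTensorProductRep_comp_localCongr B ha h ρ hρ using 2
  exact comp_finAdelicCongr_comp_finAdelicEquiv_symm B ha h ρ

end UnitaryGroup

end Literature.NumberTheory.Automorphic

end
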